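import Literature.MathematicalPhysics.KineticTheory.HardSphereEulerProofs
import Literature.Analysis.FluidPDE.HardSphereFlowJointMeasurable
import Summits.AtomisticToContinuum.HydrodynamicLimit.Theorems.OneFlightGossipEngineCollisionActivityTailsNearFieldKineticTailsStatics
import HarnessLib

/-!
# `CollisionActivityTails` (stmt-AtomisticToContinuum-13734), line `SketchK1`: the near-field pathwise bound

Helper file (`--supports stmt-AtomisticToContinuum-13734`) for the crux
`Summit.AtomisticToContinuum.HydrodynamicLimit.Theses.OneFlightGossipEngine.CollisionActivityTails`
(shared with `…Theses.TwoClocks.CollisionActivityTails`), skeleton line `SketchK1`, registered stub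
`stub_nearFieldPathwise` (statement `NearFieldPathwise`). File 2 of 3 of the reduction of the line's
near-field kinetic tail statement `NearFieldKineticTails` (stub 5) to quadratic-velocity uniform
integrability plus an in-probability tagged-sphere window law of large numbers; it consumes the statics
of `…NearFieldKineticTailsStatics` and is consumed by `…NearFieldKineticTails`.

Along a GOOD orbit of a hard-sphere flow `Φ` of `N + 1` spheres of reduced diameter `σ > 0` on `𝕋³`
(window `w = τ (N+1)^{-1/3}`, `ε = hsDiameter σ N`, near-field kinetic term
`F²_i(z) = w⁻¹ ∫_s^{s+w} Σ_{j ≠ i, dist ≤ 2ε} |v_j(t) − v_i(t)|² dt`):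

* window bookkeeping (`window_pos'`, `exists_window_le`: `w_N ≤ c` eventually in `N`);
* time integrability along good orbits of measurable observables dominated by the conserved energy
  (`intervalIntegrable_of_le_energy`; the orbit stays in the hard-sphere domain, `flow_mem_domain`);
* per particle, packing-truncation at level `4M²` integrated over the window:
  `F²_i ≤ 500 M² + w⁻¹ ∫ (fast part)_i`, hence `𝟙{1000 M² < F²_i} F²_i ≤ 2 w⁻¹ ∫ (fast part)_i`
  (`nearFieldKinetic_le_half_add`, `tailFn_nearFieldKinetic_le`);
* summed with double counting: `Σ_i 𝟙{1000 M² < F²_i} F²_i ≤ 2000 · w⁻¹ ∫_s^{s+w} Σ_i |v_i(t)|² 𝟙{M < |v_i(t)|} dt`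
  (`sum_tailFn_nearFieldKinetic_le`);
* with the scalar truncation `𝟙{V < y} y ≤ 𝟙{M' < y} y + M' 𝟙{V < y}`, `M' = 1000 M²`, the registered
  **pathwise bound** (`avgTail_nearFieldKinetic_le` = `stub_nearFieldPathwise`):
  `(N+1)⁻¹ Σ_i 𝟙{V < F²_i} F²_i ≤ 2000 · w⁻¹ ∫_s^{s+w} kinTailAvg M (Φ_t z) dt + 1000 M² · (N+1)⁻¹ Σ_i 𝟙{V < F²_i}`,
  `kinTailAvg M y = (N+1)⁻¹ Σ_i |v_i|² 𝟙{M < |v_i|}` (verbatim copy of the skeleton's).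

References: C. Cercignani, R. Illner, M. Pulvirenti, *The Mathematical Theory of Dilute Gases* (1994),
§4.2 and App. 4.A (hard-sphere flow, time averages along it); energy conservation along good orbits is
`HardSphereFlow.configEnergy_flow`.
-/

noncomputable section

open MeasureTheory Set Filter Topology
open scoped ENNReal

namespace Summit.AtomisticToContinuum.HydrodynamicLimit.Theorems.CollisionActivityTailsNearFieldKineticTails

open Literature.MathematicalPhysics.KineticTheory Literature.Analysis.FluidPDE

/-! ## §1 Windows and time integrability along good orbits -/

/-- The window `τ (N+1)^{-1/3}` is positive for `τ > 0`. -/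
theorem window_pos' {τ : ℝ} (hτ : 0 < τ) (N : ℕ) : 0 < window τ N :=
  mul_pos hτ (Real.rpow_pos_of_pos (by positivity) _)

/-- Eventually (in `N`) the window `τ (N+1)^{-1/3}` is below any positive length. -/
theorem exists_window_le {τ c : ℝ} (hτ : 0 < τ) (hc : 0 < c) :
    ∃ N₀ : ℕ, ∀ N : ℕ, N₀ ≤ N → window τ N ≤ c := by
  obtain ⟨N₀, hN₀⟩ := exists_nat_gt ((τ / c) ^ (3 : ℝ))
  refine ⟨N₀, fun N hN => ?_⟩
  have hN1 : (τ / c) ^ (3 : ℝ) ≤ (N : ℝ) + 1 := by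
    have : (N₀ : ℝ) ≤ N := by exact_mod_cast hN
    linarith
  have hpos : (0 : ℝ) < (N : ℝ) + 1 := by positivity
  have key : ((N : ℝ) + 1) ^ (-(1 / 3 : ℝ)) ≤ c / τ := by
    rw [Real.rpow_neg hpos.le, inv_le_comm₀ (Real.rpow_pos_of_pos hpos _) (div_pos hc hτ), inv_div]
    calc τ / c = ((τ / c) ^ (3 : ℝ)) ^ (1 / 3 : ℝ) := by
          rw [← Real.rpow_mul (div_pos hτ hc).le]
          norm_num
      _ ≤ ((N : ℝ) + 1) ^ (1 / 3 : ℝ) := Real.rpow_le_rpow (by positivity) hN1 (by norm_num)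
  unfold window
  calc τ * ((N : ℝ) + 1) ^ (-(1 / 3 : ℝ)) ≤ τ * (c / τ) := mul_le_mul_of_nonneg_left key hτ.le
    _ = c := by field_simp

/-- The near-field kinetic term is nonnegative. -/
theorem nearFieldKinetic_nonneg' {σ : ℝ} {N : ℕ} (Φ : Flow σ N) {τ : ℝ} (hτ : 0 < τ) (s : ℝ)
    (i : Fin (N + 1)) (z : Cfg N) : 0 ≤ nearFieldKinetic Φ τ s i z :=
  mul_nonneg (inv_nonneg.2 (window_pos' hτ N).le)
    (intervalIntegral.integral_nonneg (by linarith [window_pos' hτ N]) fun t _ => relKineticNear_nonneg' _ _ _)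

/-- Time integrability along a good orbit of a measurable observable dominated by the (conserved) energy. -/
theorem intervalIntegrable_of_le_energy {σ : ℝ} {N : ℕ} (Φ : Flow σ N) {z : Cfg N} (hz : z ∈ Φ.good)
    {g : Cfg N → ℝ} (hg : Measurable g) {C : ℝ} (hbound : ∀ y : Cfg N, |g y| ≤ C * configEnergy y)
    {a b : ℝ} (hab : a ≤ b) : IntervalIntegrable (fun t => g (Φ.flow t z)) volume a b := by
  have hγ := Φ.isTrajectory z hz
  have hmeas : Measurable fun t => g (Φ.flow t z) := hg.comp hγ.measurable_torus
  rw [intervalIntegrable_iff_integrableOn_Ioc_of_le hab]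
  refine ⟨hmeas.aestronglyMeasurable,
    HasFiniteIntegral.of_bounded (C := C * configEnergy z) (ae_of_all _ fun t => ?_)⟩
  rw [Real.norm_eq_abs, ← Φ.configEnergy_flow hz t]
  exact hbound _

/-- The empirical quadratic velocity tail `(N+1)⁻¹ Σ_i |v_i|² 𝟙{M < |v_i|}` of a configuration. -/
def kinTailAvg {N : ℕ} (M : ℝ) (y : Cfg N) : ℝ := ((N : ℝ) + 1)⁻¹ * ∑ i, kinTail M (y i).2

/-- The empirical quadratic velocity tail is nonnegative. -/
theorem kinTailAvg_nonneg {N : ℕ} (M : ℝ) (y : Cfg N) : 0 ≤ kinTailAvg M y :=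
  mul_nonneg (inv_nonneg.2 (by positivity)) (Finset.sum_nonneg fun i _ => kinTail_nonneg _ _)

/-- The empirical quadratic velocity tail is a measurable function of the configuration. -/
theorem measurable_kinTailAvg {N : ℕ} (M : ℝ) : Measurable fun y : Cfg N => kinTailAvg M y :=
  measurable_const.mul (Finset.measurable_sum _ fun i _ =>
    (show Measurable fun y : Cfg N => kinTail M (y i).2 from
      (measurable_kinTail M).comp (measurable_pi_apply i).snd))

/-- The summed quadratic velocity tail is at most twice the energy `E = ½ Σ_i |v_i|²`. -/
theorem sum_kinTail_le_energy {N : ℕ} (M : ℝ) (y : Cfg N) : ∑ i, kinTail M (y i).2 ≤ 2 * configEnergy y := by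
  have hE : 2 * configEnergy y = ∑ i, ‖(y i).2‖ ^ 2 := by
    rw [configEnergy, ← mul_assoc, mul_inv_cancel₀ two_ne_zero, one_mul]
  rw [hE]
  exact Finset.sum_le_sum fun i _ => kinTail_le_sq _ _

/-- The empirical quadratic velocity tail is dominated by the energy (crudely, dropping `(N+1)⁻¹ ≤ 1`). -/
theorem abs_kinTailAvg_le_energy {N : ℕ} (M : ℝ) (y : Cfg N) : |kinTailAvg M y| ≤ 2 * configEnergy y := by
  rw [abs_of_nonneg (kinTailAvg_nonneg M y)]
  have hsum := sum_kinTail_le_energy M y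
  have h0 : 0 ≤ ∑ i, kinTail M (y i).2 := Finset.sum_nonneg fun i _ => kinTail_nonneg _ _
  have hN : ((N : ℝ) + 1)⁻¹ ≤ 1 := inv_le_one_of_one_le₀ (by linarith [(Nat.cast_nonneg N : (0 : ℝ) ≤ N)])
  calc kinTailAvg M y = ((N : ℝ) + 1)⁻¹ * ∑ i, kinTail M (y i).2 := rfl
    _ ≤ 1 * ∑ i, kinTail M (y i).2 := mul_le_mul_of_nonneg_right hN h0
    _ ≤ 2 * configEnergy y := by rw [one_mul]; exact hsum

/-! ## §2 Along the flow: the pathwise bound on the good set -/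

section Pathwise

variable {σ : ℝ} {N : ℕ}

/-- The orbit of a good datum stays in the hard-sphere domain. -/
theorem flow_mem_domain (Φ : Flow σ N) {z : Cfg N} (hz : z ∈ Φ.good) (t : ℝ) :
    Φ.flow t z ∈ hardSphereDomain (Torus.geometry (Fin 3)) (N + 1) (hsDiameter σ N) :=
  Φ.good_subset (Φ.mapsTo_good t hz)

/-- The near-field relative kinetic energy at `i` is time-integrable along a good orbit. -/
theorem intervalIntegrable_relKineticNear' (Φ : Flow σ N) {z : Cfg N} (hz : z ∈ Φ.good)
    (i : Fin (N + 1)) (r : ℝ) {a b : ℝ} (hab : a ≤ b) :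
    IntervalIntegrable (fun t => relKineticNear (Φ.flow t z) i r) volume a b :=
  intervalIntegrable_of_le_energy Φ hz (measurable_relKineticNear i r)
    (fun y => by
      rw [abs_of_nonneg (relKineticNear_nonneg' y i _)]
      exact relKineticNear_le_energy' y i _) hab

/-- The fast near-field relative kinetic energy at `i` is time-integrable along a good orbit. -/
theorem intervalIntegrable_relKineticFast (Φ : Flow σ N) {z : Cfg N} (hz : z ∈ Φ.good)
    (i : Fin (N + 1)) (r L : ℝ) {a b : ℝ} (hab : a ≤ b) :
    IntervalIntegrable (fun t => relKineticFast (Φ.flow t z) i r L) volume a b :=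
  intervalIntegrable_of_le_energy Φ hz (measurable_relKineticFast i r L)
    (fun y => by
      rw [abs_of_nonneg (relKineticFast_nonneg y i _ _)]
      exact (relKineticFast_le_relKineticNear y i _ _).trans (relKineticNear_le_energy' y i _)) hab

/-- The summed fast near-field relative kinetic energy is time-integrable along a good orbit. -/
theorem intervalIntegrable_sum_relKineticFast (Φ : Flow σ N) {z : Cfg N} (hz : z ∈ Φ.good)
    (r L : ℝ) {a b : ℝ} (hab : a ≤ b) :
    IntervalIntegrable (fun t => ∑ i, relKineticFast (Φ.flow t z) i r L) volume a b := by
  have hfun : (fun t => ∑ i, relKineticFast (Φ.flow t z) i r L) =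
      ∑ i ∈ (Finset.univ : Finset (Fin (N + 1))), fun t => relKineticFast (Φ.flow t z) i r L := by
    funext t
    simp only [Finset.sum_apply]
  rw [hfun]
  exact IntervalIntegrable.sum Finset.univ
    fun i (_ : i ∈ Finset.univ) => intervalIntegrable_relKineticFast Φ hz i r L hab

/-- The summed quadratic velocity tail is time-integrable along a good orbit. -/
theorem intervalIntegrable_sum_kinTail (Φ : Flow σ N) {z : Cfg N} (hz : z ∈ Φ.good) (M : ℝ)
    {a b : ℝ} (hab : a ≤ b) :
    IntervalIntegrable (fun t => ∑ i, kinTail M ((Φ.flow t z) i).2) volume a b := by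
  have hmeas : Measurable fun y : Cfg N => ∑ i, kinTail M (y i).2 :=
    Finset.measurable_sum _ fun i _ =>
      (show Measurable fun y : Cfg N => kinTail M (y i).2 from
        (measurable_kinTail M).comp (measurable_pi_apply i).snd)
  have hbound : ∀ y : Cfg N, |∑ i, kinTail M (y i).2| ≤ 2 * configEnergy y := fun y => by
    rw [abs_of_nonneg (Finset.sum_nonneg fun i _ => kinTail_nonneg M (y i).2)]
    exact sum_kinTail_le_energy M y
  exact intervalIntegrable_of_le_energy Φ hz (g := fun y : Cfg N => ∑ i, kinTail M (y i).2) hmeas hbound hab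

/-- The empirical quadratic velocity tail is time-integrable along a good orbit. -/
theorem intervalIntegrable_kinTailAvg (Φ : Flow σ N) {z : Cfg N} (hz : z ∈ Φ.good) (M : ℝ)
    {a b : ℝ} (hab : a ≤ b) :
    IntervalIntegrable (fun t => kinTailAvg M (Φ.flow t z)) volume a b :=
  intervalIntegrable_of_le_energy Φ hz (measurable_kinTailAvg M) (C := 2)
    (fun y => abs_kinTailAvg_le_energy M y) hab

/-- Per particle: `F²_i ≤ 500 M² + w⁻¹ ∫ (fast part at level 4M²)_i` on the good set. -/
theorem nearFieldKinetic_le_half_add (hσ : 0 < σ) (Φ : Flow σ N) {τ : ℝ} (hτ : 0 < τ) (s : ℝ)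
    {z : Cfg N} (hz : z ∈ Φ.good) (M : ℝ) (i : Fin (N + 1)) :
    nearFieldKinetic Φ τ s i z ≤ 1000 * M ^ 2 / 2 + (window τ N)⁻¹ *
      ∫ t in s..(s + window τ N), relKineticFast (Φ.flow t z) i (2 * hsDiameter σ N) (4 * M ^ 2) := by
  have hw0 : 0 < window τ N := window_pos' hτ N
  have hε0 : 0 < hsDiameter σ N := hsDiameter_pos hσ N
  have hsw : s ≤ s + window τ N := le_add_of_nonneg_right hw0.le
  have hmono : (∫ t in s..(s + window τ N), relKineticNear (Φ.flow t z) i (2 * hsDiameter σ N)) ≤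
      ∫ t in s..(s + window τ N), ((125 * (4 * M ^ 2) : ℝ) +
        relKineticFast (Φ.flow t z) i (2 * hsDiameter σ N) (4 * M ^ 2)) :=
    intervalIntegral.integral_mono_on hsw (intervalIntegrable_relKineticNear' Φ hz i _ hsw)
      (intervalIntegrable_const.add (intervalIntegrable_relKineticFast Φ hz i _ _ hsw))
      fun t _ => relKineticNear_le_add_fast hε0 (flow_mem_domain Φ hz t) i (by positivity)
  rw [intervalIntegral.integral_add intervalIntegrable_const (intervalIntegrable_relKineticFast Φ hz i _ _ hsw),
    intervalIntegral.integral_const, smul_eq_mul, add_sub_cancel_left] at hmono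
  unfold nearFieldKinetic
  calc (window τ N)⁻¹ * ∫ t in s..(s + window τ N), relKineticNear (Φ.flow t z) i (2 * hsDiameter σ N)
      ≤ (window τ N)⁻¹ * (window τ N * (125 * (4 * M ^ 2)) +
          ∫ t in s..(s + window τ N), relKineticFast (Φ.flow t z) i (2 * hsDiameter σ N) (4 * M ^ 2)) :=
        mul_le_mul_of_nonneg_left hmono (inv_nonneg.2 hw0.le)
    _ = 1000 * M ^ 2 / 2 + (window τ N)⁻¹ *
          ∫ t in s..(s + window τ N), relKineticFast (Φ.flow t z) i (2 * hsDiameter σ N) (4 * M ^ 2) := by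
        rw [mul_add, ← mul_assoc, inv_mul_cancel₀ hw0.ne', one_mul]
        ring

/-- Per particle: `𝟙{1000 M² < F²_i} F²_i ≤ 2 w⁻¹ ∫ (fast part)_i` on the good set. -/
theorem tailFn_nearFieldKinetic_le (hσ : 0 < σ) (Φ : Flow σ N) {τ : ℝ} (hτ : 0 < τ) (s : ℝ)
    {z : Cfg N} (hz : z ∈ Φ.good) (M : ℝ) (i : Fin (N + 1)) :
    tailFn (1000 * M ^ 2) (nearFieldKinetic Φ τ s i z) ≤ 2 * ((window τ N)⁻¹ *
      ∫ t in s..(s + window τ N), relKineticFast (Φ.flow t z) i (2 * hsDiameter σ N) (4 * M ^ 2)) :=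
  tailFn_le_two_mul (mul_nonneg (inv_nonneg.2 (window_pos' hτ N).le)
    (intervalIntegral.integral_nonneg (le_add_of_nonneg_right (window_pos' hτ N).le)
      fun _ _ => relKineticFast_nonneg _ _ _ _)) (nearFieldKinetic_le_half_add hσ Φ hτ s hz M i)

/-- Summed over the particles, with double counting:
`Σ_i 𝟙{1000 M² < F²_i} F²_i ≤ 2000 · w⁻¹ ∫_s^{s+w} Σ_i |v_i(t)|² 𝟙{M < |v_i(t)|} dt`. -/
theorem sum_tailFn_nearFieldKinetic_le (hσ : 0 < σ) (Φ : Flow σ N) {τ : ℝ} (hτ : 0 < τ) (s : ℝ)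
    {z : Cfg N} (hz : z ∈ Φ.good) (M : ℝ) :
    ∑ i, tailFn (1000 * M ^ 2) (nearFieldKinetic Φ τ s i z) ≤
      2000 * ((window τ N)⁻¹ * ∫ t in s..(s + window τ N), ∑ i, kinTail M ((Φ.flow t z) i).2) := by
  have hw0 : 0 < window τ N := window_pos' hτ N
  have hε0 : 0 < hsDiameter σ N := hsDiameter_pos hσ N
  have hsw : s ≤ s + window τ N := le_add_of_nonneg_right hw0.le
  calc ∑ i, tailFn (1000 * M ^ 2) (nearFieldKinetic Φ τ s i z)
      ≤ ∑ i, 2 * ((window τ N)⁻¹ * ∫ t in s..(s + window τ N),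
          relKineticFast (Φ.flow t z) i (2 * hsDiameter σ N) (4 * M ^ 2)) :=
        Finset.sum_le_sum fun i _ => tailFn_nearFieldKinetic_le hσ Φ hτ s hz M i
    _ = 2 * ((window τ N)⁻¹ * ∫ t in s..(s + window τ N),
          ∑ i, relKineticFast (Φ.flow t z) i (2 * hsDiameter σ N) (4 * M ^ 2)) := by
        rw [intervalIntegral.integral_finsetSum fun i _ => intervalIntegrable_relKineticFast Φ hz i _ _ hsw,
          Finset.mul_sum, Finset.mul_sum]
    _ ≤ 2 * ((window τ N)⁻¹ * ∫ t in s..(s + window τ N), 1000 * ∑ i, kinTail M ((Φ.flow t z) i).2) := by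
        refine mul_le_mul_of_nonneg_left (mul_le_mul_of_nonneg_left ?_ (inv_nonneg.2 hw0.le)) (by norm_num)
        exact intervalIntegral.integral_mono_on hsw (intervalIntegrable_sum_relKineticFast Φ hz _ _ hsw)
          ((intervalIntegrable_sum_kinTail Φ hz M hsw).const_mul _)
          fun t _ => sum_relKineticFast_le hε0 (flow_mem_domain Φ hz t) M
    _ = 2000 * ((window τ N)⁻¹ * ∫ t in s..(s + window τ N), ∑ i, kinTail M ((Φ.flow t z) i).2) := by
        rw [intervalIntegral.integral_const_mul]
        ring

/-- **PATHWISE BOUND (the heart of the reduction).** On the good set, for `σ, τ > 0`, every cut-off `M` and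
every level `V`:
`(N+1)⁻¹ Σ_i 𝟙{V < F²_i} F²_i ≤ 2000 · w⁻¹ ∫_s^{s+w} (N+1)⁻¹ Σ_i |v_i(t)|² 𝟙{M < |v_i(t)|} dt
  + 1000 M² · (N+1)⁻¹ Σ_i 𝟙{V < F²_i}`. -/
theorem avgTail_nearFieldKinetic_le (hσ : 0 < σ) (Φ : Flow σ N) {τ : ℝ} (hτ : 0 < τ) (s : ℝ)
    {z : Cfg N} (hz : z ∈ Φ.good) (M V : ℝ) :
    ((N : ℝ) + 1)⁻¹ * ∑ i, tailFn V (nearFieldKinetic Φ τ s i z) ≤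
      2000 * ((window τ N)⁻¹ * ∫ t in s..(s + window τ N), kinTailAvg M (Φ.flow t z)) +
        1000 * M ^ 2 * (((N : ℝ) + 1)⁻¹ * ∑ i, fracFn V (nearFieldKinetic Φ τ s i z)) := by
  have hN0 : (0 : ℝ) ≤ ((N : ℝ) + 1)⁻¹ := inv_nonneg.2 (by positivity)
  have htrunc : ∑ i, tailFn V (nearFieldKinetic Φ τ s i z) ≤
      ∑ i, tailFn (1000 * M ^ 2) (nearFieldKinetic Φ τ s i z) +
        1000 * M ^ 2 * ∑ i, fracFn V (nearFieldKinetic Φ τ s i z) := by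
    rw [Finset.mul_sum, ← Finset.sum_add_distrib]
    exact Finset.sum_le_sum fun i _ =>
      tailFn_le_tailFn_add_mul_fracFn (by positivity) (nearFieldKinetic_nonneg' Φ hτ s i z)
  have havg : ((window τ N)⁻¹ * ∫ t in s..(s + window τ N), kinTailAvg M (Φ.flow t z)) =
      ((N : ℝ) + 1)⁻¹ * ((window τ N)⁻¹ * ∫ t in s..(s + window τ N), ∑ i, kinTail M ((Φ.flow t z) i).2) := by
    unfold kinTailAvg
    rw [intervalIntegral.integral_const_mul]
    ring
  rw [havg]
  calc ((N : ℝ) + 1)⁻¹ * ∑ i, tailFn V (nearFieldKinetic Φ τ s i z)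
      ≤ ((N : ℝ) + 1)⁻¹ * (∑ i, tailFn (1000 * M ^ 2) (nearFieldKinetic Φ τ s i z) +
          1000 * M ^ 2 * ∑ i, fracFn V (nearFieldKinetic Φ τ s i z)) := mul_le_mul_of_nonneg_left htrunc hN0
    _ ≤ ((N : ℝ) + 1)⁻¹ * (2000 * ((window τ N)⁻¹ * ∫ t in s..(s + window τ N),
          ∑ i, kinTail M ((Φ.flow t z) i).2) + 1000 * M ^ 2 * ∑ i, fracFn V (nearFieldKinetic Φ τ s i z)) :=
        mul_le_mul_of_nonneg_left (add_le_add (sum_tailFn_nearFieldKinetic_le hσ Φ hτ s hz M) le_rfl) hN0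
    _ = 2000 * (((N : ℝ) + 1)⁻¹ * ((window τ N)⁻¹ * ∫ t in s..(s + window τ N),
          ∑ i, kinTail M ((Φ.flow t z) i).2)) +
          1000 * M ^ 2 * (((N : ℝ) + 1)⁻¹ * ∑ i, fracFn V (nearFieldKinetic Φ τ s i z)) := by ring

end Pathwise

/-! ## §3 The registered statement -/

/-- **NEAR-FIELD PATHWISE BOUND** (stub 5f of line `SketchK1`; verbatim from the registered skeleton): on the good
set, for `σ, τ > 0`, every cut-off `M` and level `V`,
`(N+1)⁻¹ Σ_i 𝟙{V < F²_i} F²_i ≤ 2000 · w⁻¹ ∫_s^{s+w} (N+1)⁻¹ Σ_i |v_i(t)|² 𝟙{M < |v_i(t)|} dt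
  + 1000 M² · (N+1)⁻¹ Σ_i 𝟙{V < F²_i}`. -/
def NearFieldPathwise : Prop :=
  ∀ (σ : ℝ), 0 < σ → ∀ (N : ℕ) (Φ : Flow σ N) (τ : ℝ), 0 < τ → ∀ (s : ℝ), ∀ z ∈ Φ.good, ∀ M V : ℝ,
    ((N : ℝ) + 1)⁻¹ * ∑ i : Fin (N + 1), tailFn V (nearFieldKinetic Φ τ s i z) ≤
      2000 * ((window τ N)⁻¹ * ∫ t in s..(s + window τ N), kinTailAvg M (Φ.flow t z)) +
        1000 * M ^ 2 * (((N : ℝ) + 1)⁻¹ * ∑ i : Fin (N + 1), fracFn V (nearFieldKinetic Φ τ s i z))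

/-- **STUB 5f (`stub_nearFieldPathwise`, line `SketchK1`).** The pathwise bound on the good set
(`avgTail_nearFieldKinetic_le`), in the registered quantifier shape. -/
theorem stub_nearFieldPathwise : NearFieldPathwise := fun _σ hσ _N Φ _τ hτ s _z hz M V =>
  avgTail_nearFieldKinetic_le hσ Φ hτ s hz M V

end Summit.AtomisticToContinuum.HydrodynamicLimit.Theorems.CollisionActivityTailsNearFieldKineticTails

end
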